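import Summits.QuantumFields.YangMills.Theorems.BalabanLadderIRRankPurityCofinal
import HarnessLib

/-!
# Crux `BalabanLadder.IR` ∕ `IRcof` (stmt-QuantumFields-19354 ∕ 26930) — LINE D-cof «rank-purity under the cofinal quantifier», rev 2
# (ideator ym-ir-idea-14 gen 4; lens strengthen-to-induct on the residual token N, re-typed for the cofinal leaf of record №27)

HONESTY.  Nothing here proves the Clay Yang–Mills mass gap, a lattice gap, `IRnsc`, `IRnscCof`, `IRcof` or `BalabanLadder.IR`;
`R4` closes only the conditional finite-𝕋⁴ rung `BalabanLadder.UV`.  Counts unmoved.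

REV 2 (after crit-4 g3 VERDICT-rank-purity-cofinal PASS-WITH-PRICE 6f24d696239a and crit-1 V23; LANDED sorry-free parts p622200
`Theorems/BalabanLadderIRRankPurityCofinalDefs.lean` 2366eedd04bc + p622443 `Theorems/BalabanLadderIRRankPurityCofinal.lean` e22843a882bc):
this workfile is now THIN — it IMPORTS the landed objects, statements and seams (`RqExit`, `rqLen`, `IRnscCof`, `IRscCof`, K1ᴷ
`RankExitsUnbounded`, Xᴷ `AFToRankExit`, BLINDᴷ′ `BlindAt`, `PinnedRankExitCof`, `MultipletPinnedOn`, `gapOn_of_lightCode_pinned_onSet`,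
`lightMultiplet_of_exit_at`, `pinnedRankExitCof_of`, `multipletPinnedOn_of`, `irnscCof_of_multipletPinnedOn`, `irnscCof_of`, `IRcof_of_split`,
`irscCof_of_K1_X`, `IRcof_of`) instead of restating them, binds K1 as the landed `ScalingHeredity.CofinalExitAt (1/24)` BY NAME, and ADDS
§5b: the JOINT TOKEN J = `RankBasinVisited` (crit-1 V23's optional sharpening «K1ᴷ at θ = η(Rᴷ)», typed): ONE basin datum
`(Q, C, η, β₀, S₀)` for which Rᴷ's basin clause holds AND the theory visits the basin cofinally (exits at the basin tolerance
`basinTol C η = 1/(16·max C (max 2 (1/η)))` above the basin floor).  J is BY-NAME WEAKER than K1ᴷ ∧ Rᴷ (`rankBasinVisited_of`) and still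
sufficient: `multipletPinnedOn_of_visited : J → Xᴷ → S⁺cof`, `irnscCof_of_visited : J → Xᴷ → BLINDᴷ′ → N_cof`, `IRcof_of_visited :
K1 → X → J → Xᴷ → BLINDᴷ′ → IRcof` (all PROVED) — a 5-token cut of the same bill (count 6 ↦ 5), offered, not imposed: the six registered
stubs of rev 1 stay as they were priced, and `IRcof_of_stubs` still concludes `Theses.BalabanLadder.IRcof` BY NAME from them.
-/

set_option autoImplicit false

noncomputable section

open Filter Topology MeasureTheory
open scoped BigOperators
open Literature.MathematicalPhysics.QuantumFieldTheory Literature.MathematicalPhysics.QuantumLattice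
open Summit.QuantumFields.YangMills.Cruxes.OSLegsFromFemtoAndGap.DlrCollarTransfer (GapInUnits LowerBounds Q2)
open Summit.QuantumFields.YangMills.Theorems.WeakCouplingHypercubicLimit.TraceNormColdPressure
open Summit.QuantumFields.YangMills.Cruxes.IR.FluxCodeBlindness
open Summit.QuantumFields.YangMills.Cruxes.IR.ColdPressurePincer (IRsc IRnsc AFToColdPressure)
open Summit.QuantumFields.YangMills.Cruxes.IR.ScalingHeredity (CofinalExitAt)

namespace Summit.QuantumFields.YangMills.Cruxes.IR.RankPurity

/-! ## §5b The JOINT TOKEN J = `RankBasinVisited` (crit-1 V23's sharpening «K1ᴷ at θ = η(Rᴷ)»): by-name WEAKER than K1ᴷ ∧ Rᴷ,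
and still sufficient — exits are asked only at the basin tolerance and floor of ONE basin datum `(Q, C, η, β₀, S₀)`. -/

/-- The basin tolerance attached to a basin datum `(C, η)`: `θ⋆ = 1 / (16 · max C (max 2 (1/η)))`. -/
def basinTol (C η : ℝ) : ℝ := 1 / (16 * max C (max 2 (1 / η)))

/-- **J `RankBasinVisited` — THE RANK-`Q` TAIL HAS A CONTRACTING BASIN AND THE THEORY VISITS IT COFINALLY.**  HYPOTHESIS-side `Prop`.
For compact simple `G` with `π₁(G) ≠ 1` and every `r`: ONE datum `(Q, C, η, β₀, S₀)` such that (i) Rᴷ's basin clause holds for it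
(rank-`Q` tails `≤ η` square with constant `C` under `S ↦ S' ∈ [2S, 4S]` at every `β ≥ β₀`, `S ≥ S₀`) and (ii) cofinally in `β`, past `β₀`,
SOME torus of half-side `≥ max S₀ 1` is a rank-`Q` exit at the basin tolerance `basinTol C η`.  Weaker by name than K1ᴷ ∧ Rᴷ
(`rankBasinVisited_of`: K1ᴷ asks exits at EVERY tolerance and floor, Rᴷ a basin at EVERY rank); with Xᴷ and BLINDᴷ′ it still gives
N_cof (`irnscCof_of_visited`).  Why it might fail: as K1ᴷ ∕ Rᴷ (no confinement-scale purity; no scale-stable excused set). -/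
def RankBasinVisited : Prop :=
  ∀ (G : Type) [Group G] [TopologicalSpace G] [IsTopologicalGroup G] [CompactSpace G],
    IsCompactSimpleLieGroup G → ¬ SimplyConnectedSpace G →
    letI : MeasurableSpace G := borel G
    haveI : BorelSpace G := ⟨rfl⟩
    ∀ r : LatticeRep G, ∃ (Q : ℕ) (C η β₀ : ℝ) (S₀ : ℕ), 0 < C ∧ 0 < η ∧
      (∀ β : ℝ, β₀ ≤ β → ∀ S : ℕ, S₀ ≤ S → ∀ S' : ℕ, 2 * S ≤ S' → S' ≤ 4 * S →
        ∀ (ι : Type) [DecidableEq ι] (rr : ι → ℝ) (i₀ : ι), IsRatioDatum r.ρ β (2 * S + 1) ι rr i₀ →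
          ∀ F : Finset ι, i₀ ∉ F → F.card ≤ Q → rankTail r.ρ β (2 * S + 1) rr F (coldExp S) ≤ η →
            ∀ (ι' : Type) [DecidableEq ι'] (rr' : ι' → ℝ) (i₀' : ι'), IsRatioDatum r.ρ β (2 * S' + 1) ι' rr' i₀' →
              ∃ F' : Finset ι', i₀' ∉ F' ∧ F'.card ≤ Q ∧
                rankTail r.ρ β (2 * S' + 1) rr' F' (coldExp S') ≤ C * rankTail r.ρ β (2 * S + 1) rr F (coldExp S) ^ 2) ∧
      (∀ x : ℝ, ∃ β : ℝ, x ≤ β ∧ β₀ ≤ β ∧ ∃ S : ℕ, max S₀ 1 ≤ S ∧ RqExit r β Q (basinTol C η) S)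

/-- **K1ᴷ ∧ Rᴷ ⇒ J** (J is by-name weaker than the pair). -/
theorem rankBasinVisited_of (hK : RankExitsUnbounded) (hR : RankTailSquaring) : RankBasinVisited := by
  intro G _ _ _ _ hG hnsc
  letI : MeasurableSpace G := borel G
  haveI : BorelSpace G := ⟨rfl⟩
  intro r
  obtain ⟨Q, hQ⟩ := hK G hG hnsc r
  obtain ⟨C, η, β₀, S₀, hC, hη, hrec⟩ := hR G hG hnsc r Q
  have hC' : 0 < max C (max 2 (1 / η)) := lt_of_lt_of_le hC (le_max_left _ _)
  refine ⟨Q, C, η, β₀, S₀, hC, hη, fun β hβ S hS S' h2 h4 ι _ rr i₀ hd F hF hc hFη ι' _ rr' i₀' hd' =>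
    hrec β hβ S hS S' h2 h4 ι rr i₀ hd F hF hc hFη ι' rr' i₀' hd', fun x => ?_⟩
  obtain ⟨β, hβx, S, hS, hex⟩ := hQ (basinTol C η) (by unfold basinTol; positivity) (max S₀ 1) (max x β₀)
  exact ⟨β, le_trans (le_max_left _ _) hβx, le_trans (le_max_right _ _) hβx, S, hS, hex⟩

/-- **J ∧ Xᴷ ⇒ S⁺cof** (pin from `pinned_of_AF` at the ONE tolerance and floor of the basin datum; per-coupling seam §4 on the exit set). -/
theorem multipletPinnedOn_of_visited (hJ : RankBasinVisited) (hX : AFToRankExit) : MultipletPinnedOn := by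
  intro G _ _ _ _ hG hnsc
  letI : MeasurableSpace G := borel G
  haveI : BorelSpace G := ⟨rfl⟩
  intro r a ha ha0 hlb
  haveI : SecondCountableTopology G :=
    (r.continuous.isClosedEmbedding r.injective).isEmbedding.secondCountableTopology
  obtain ⟨Q, C, η, β₀, S₀, hC, hη, hrec, hvis⟩ := hJ G hG hnsc r
  set θ := basinTol C η with hθdef
  have hθ : 0 < θ := by rw [hθdef]; unfold basinTol; positivity
  obtain ⟨T, β₆, hpin⟩ := pinned_of_AF r a ha hlb (fun β => rqLen r β Q θ (max S₀ 1)) (hX G hG hnsc r Q θ (max S₀ 1) hθ)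
  obtain ⟨β₇, hβ₇⟩ : ∃ β₇ : ℝ, ∀ β : ℝ, β₇ ≤ β → a β ≤ 1 := by
    have hev : ∀ᶠ β in atTop, a β < 1 := ha0.eventually (gt_mem_nhds one_pos)
    obtain ⟨β₇, h⟩ := Filter.eventually_atTop.1 hev
    exact ⟨β₇, fun β hβ => (h β hβ).le⟩
  refine ⟨Q, 2 * T + 1, {β : ℝ | max β₀ 0 ≤ β ∧ ∃ S : ℕ, max S₀ 1 ≤ S ∧ a β * ((2 * S + 1 : ℕ) : ℝ) ≤ 2 * T + 1 ∧
      RqExit r β Q θ S}, fun x => ?_, ?_⟩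
  · obtain ⟨β, hβx, hββ₀, S, hS, hex⟩ := hvis (max (max x 0) (max β₆ β₇))
    have hx : x ≤ β := le_trans ((le_max_left _ _).trans (le_max_left _ _)) hβx
    have h0 : (0 : ℝ) ≤ β := le_trans ((le_max_right _ _).trans (le_max_left _ _)) hβx
    have hβ6 : β₆ ≤ β := le_trans ((le_max_left _ _).trans (le_max_right _ _)) hβx
    have hβ7 : β₇ ≤ β := le_trans ((le_max_right _ _).trans (le_max_right _ _)) hβx
    obtain ⟨hlen0, hlenex⟩ := rqLen_spec r hS hex
    refine ⟨β, ⟨max_le hββ₀ h0, rqLen r β Q θ (max S₀ 1), hlen0, ?_, hlenex⟩, hx⟩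
    have hp := hpin β hβ6
    have ha1 := hβ₇ β hβ7
    have hcast : (((2 * rqLen r β Q θ (max S₀ 1) + 1 : ℕ) : ℝ)) = 2 * (rqLen r β Q θ (max S₀ 1) : ℝ) + 1 := by
      push_cast; ring
    rw [hcast]
    nlinarith [ha β, (ha β).le]
  · rintro β ⟨hβ, S, hS, hpinS, hex⟩
    have hββ₀ : β₀ ≤ β := le_trans (le_max_left _ _) hβ
    have hβ0 : (0 : ℝ) ≤ β := le_trans (le_max_right _ _) hβ
    have hS0 : S₀ ≤ S := le_trans (le_max_left _ _) hS
    have hS1 : 1 ≤ S := le_trans (le_max_right _ _) hS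
    refine ⟨S, hS1, ?_, lightMultiplet_of_exit_at r hβ0 hC hη
      (fun S₁ hS₁ S' h2 h4 ι _ rr i₀ hd F hF hc hFη ι' _ rr' i₀' hd' =>
        hrec β hββ₀ S₁ hS₁ S' h2 h4 ι rr i₀ hd F hF hc hFη ι' rr' i₀' hd') hS0 hS1 hex⟩
    have h1 : (S : ℝ) ≤ ((2 * S + 1 : ℕ) : ℝ) := by exact_mod_cast (by omega : S ≤ 2 * S + 1)
    exact (mul_le_mul_of_nonneg_left h1 (ha β).le).trans hpinS

/-- **J ∧ Xᴷ ∧ BLINDᴷ′ ⇒ N_cof** — the 3-token nsc bill (count: K1ᴷ, Rᴷ ↦ J). -/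
theorem irnscCof_of_visited (hJ : RankBasinVisited) (hX : AFToRankExit) (hB : BlindAt) : IRnscCof :=
  irnscCof_of_multipletPinnedOn (multipletPinnedOn_of_visited hJ hX) hB

/-! ## §6b The 5-token composition -/

/-- **The 5-token uniform cofinal bill: (K1 ∧ X) ∧ (J ∧ Xᴷ ∧ BLINDᴷ′) ⇒ `IRcof` BY NAME.** -/
theorem IRcof_of_visited (hK1 : CofinalExitAt (1 / 24)) (hX : AFToColdPressure) (hJ : RankBasinVisited) (hXK : AFToRankExit)
    (hB : BlindAt) : Summit.QuantumFields.YangMills.Theses.BalabanLadder.IRcof :=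
  IRcof_of_split (irscCof_of_K1_X hK1 hX) (irnscCof_of_visited hJ hXK hB)

/-! ## §7 Registered stubs and the concluding composition -/

/-- stub K1 (sc, OF RECORD): the LANDED `ScalingHeredity.CofinalExitAt (1/24)` BY NAME — definitionally (`Iff.rfl`, crit-4 T2) the
`ExitsUnboundedAt (1/24)` of `Lines/cofinal_leaf.lean`; no copy of the K1 text in this file (crit-4 ∕ crit-1 LAND condition). -/
theorem stub_K1 : CofinalExitAt (1 / 24) := by
  sorry

/-- stub X (sc, OF RECORD; `ColdPressurePincer.AFToColdPressure` BY NAME). -/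
theorem stub_X : AFToColdPressure := by
  sorry

/-- stub K1ᴷ — rank-`Q` exits unbounded in the coupling (unit-free). -/
theorem stub_rankExitsUnbounded : RankExitsUnbounded := by
  sorry

/-- stub Xᴷ — asymptotic freedom up to the rank-`Q` exit length. -/
theorem stub_afToRankExit : AFToRankExit := by
  sorry

/-- stub Rᴷ — rank-`Q` tail squaring in the basin (LINE D's, BY NAME from the landed `BalabanLadderIRRankPurityDefs`). -/
theorem stub_rankTailSquaring : RankTailSquaring := by
  sorry

/-- stub BLINDᴷ′ — flux-code blindness per coupling. -/
theorem stub_blindAt : BlindAt := by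
  sorry

/-- **The six registered stubs conclude the cofinal item of record BY NAME** (`Theses.BalabanLadder.IRcof`, stmt-QuantumFields-26930;
`Theses.BalabanLadder.IR` 19354 is its supplier by `IRcof_of_IR`). -/
theorem IRcof_of_stubs : Summit.QuantumFields.YangMills.Theses.BalabanLadder.IRcof :=
  IRcof_of stub_K1 stub_X stub_rankExitsUnbounded stub_afToRankExit stub_rankTailSquaring stub_blindAt

end Summit.QuantumFields.YangMills.Cruxes.IR.RankPurity
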